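import Literature.Barriers.CriticalPhenomena.GridSAWGridFormulaGraphExplicit
import HarnessLib

/-!
# The edge list of the grid graph of a formula has no repeated (unordered) pair

For the grid drawing of `Literature.Combinatorics.SimpleGraph.GridFormula.graphOf ψ`
(Liśkiewicz–Ogihara–Toda 2003, Lemma 4 / Theorem 7; tree fact `GridSAW.LOT2003_lemma4_gadgets`)
no two drawn edges may have the same pair of ends. This is a property of the explicit edge list
`GridFormulaFP.edgesOf ψ` (`GridSAWGridFormulaGraphExplicit.lean`):

* `UDistinct e e'` — the two pairs differ as unordered pairs;
* `rpEdgesN_pairwise` — the edges of a placed rail gadget are pairwise distinct (slot ends below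
  the base, rung ends among the nodes and distinct);
* `chainEdgesN_pairwise`, `placeEdges_pairwise`, **`edgesOf_pairwise`**.

## References

* M. Liśkiewicz, M. Ogihara, S. Toda, TCS 304 (2003) 129–156, §4 (proof of Theorem 7).
-/

namespace Literature.Barriers.CriticalPhenomena.GridSAW

namespace GridFormulaFP

open Literature.Computability.Complexity (CNF)
open Literature.Combinatorics.SimpleGraph Literature.Combinatorics.SimpleGraph.GridFormula
open Literature.Combinatorics.SimpleGraph.GridFormula.Slot
open Literature.Combinatorics.SimpleGraph.GridCell (CellTy conn vtx)

/-- **Two pairs differ as unordered pairs.** [folklore] -/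
def UDistinct (e e' : ℕ × ℕ) : Prop := ¬ ((e.1 = e'.1 ∧ e.2 = e'.2) ∨ (e.1 = e'.2 ∧ e.2 = e'.1))

/-- `UDistinct` is symmetric. [folklore] -/
theorem UDistinct.symm {e e' : ℕ × ℕ} (h : UDistinct e e') : UDistinct e' e := by
  unfold UDistinct at *; omega

/-- A sufficient condition: the first end of `e` is not an end of `e'`. [folklore] -/
theorem udistinct_of_fst {e e' : ℕ × ℕ} (h1 : e.1 ≠ e'.1) (h2 : e.1 ≠ e'.2) : UDistinct e e' := by
  unfold UDistinct; omega

/-- A sufficient condition: the second end of `e` is not an end of `e'`. [folklore] -/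
theorem udistinct_of_snd {e e' : ℕ × ℕ} (h1 : e.2 ≠ e'.1) (h2 : e.2 ≠ e'.2) : UDistinct e e' := by
  unfold UDistinct; omega

/-! ### Rail gadgets -/

/-- The shape of the ends of a rail edge: the first end is a port (below the base) or a node of
the rail, the second end is a node of the rail. [folklore] -/
theorem railEdgesN_shape {K base u v r : ℕ} (hK : 1 ≤ K) (hu : u < base) (hv : v < base) {e : ℕ × ℕ}
    (he : e ∈ railEdgesN K base u v r) :
    (e.1 < base ∨ ∃ t < K, e.1 = base + r * K + t) ∧ ∃ t < K, e.2 = base + r * K + t := by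
  rcases mem_railEdgesN_iff.1 he with rfl | ⟨i, hi, rfl⟩ | rfl
  · exact ⟨Or.inl hu, 0, by omega, by simp⟩
  · exact ⟨Or.inr ⟨i, by omega, rfl⟩, i + 1, hi, rfl⟩
  · exact ⟨Or.inl hv, K - 1, by omega, rfl⟩

/-- **The edges of a placed rail gadget are pairwise distinct as unordered pairs**, provided the
rails have at least two nodes, the slot ends lie below the base, and every rung joins two distinct
nodes. [folklore] -/
theorem rpEdgesN_pairwise {k K m base : ℕ} {ends : ℕ → ℕ × ℕ} {fstC sndC : ℕ → ℕ} (hK : 2 ≤ K)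
    (hends : ∀ r < k, (ends r).1 < base ∧ (ends r).2 < base)
    (hfs : ∀ ρ < m, fstC ρ < k * K ∧ sndC ρ < k * K ∧ fstC ρ ≠ sndC ρ) :
    (rpEdgesN k K m base ends fstC sndC).Pairwise UDistinct := by
  -- node codes of different rails are apart; all node codes are below `k K`
  have hsep : ∀ {r r' t t' : ℕ}, r < r' → t < K → r * K + t < r' * K + t' := by
    intro r r' t t' hlt ht
    have : (r + 1) * K ≤ r' * K := Nat.mul_le_mul_right _ hlt
    rw [Nat.add_mul, one_mul] at this; omega
  have hlt : ∀ {r t : ℕ}, r < k → t < K → r * K + t < k * K := fun {r t} hr ht => by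
    have : (r + 1) * K ≤ k * K := Nat.mul_le_mul_right _ hr
    rw [Nat.add_mul, one_mul] at this; omega
  -- shapes of rail edges and rung edges
  have railShape : ∀ {x : ℕ × ℕ}, x ∈ (List.range k).flatMap (fun r => railEdgesN K base (ends r).1 (ends r).2 r) →
      ∃ r < k, (x.1 < base ∨ ∃ t < K, x.1 = base + r * K + t) ∧ ∃ t < K, x.2 = base + r * K + t := by
    intro x hx
    obtain ⟨r, hr, hx⟩ := List.mem_flatMap.1 hx
    have hr' := List.mem_range.1 hr
    obtain ⟨hu, hv⟩ := hends r hr'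
    exact ⟨r, hr', railEdgesN_shape (by omega) hu hv hx⟩
  have rungShape : ∀ {y : ℕ × ℕ}, y ∈ (List.range m).flatMap (fun ρ => [(base + (k * K + ρ), base + fstC ρ), (base + (k * K + ρ), base + sndC ρ)]) →
      ∃ ρ < m, y.1 = base + (k * K + ρ) ∧ ∃ c < k * K, y.2 = base + c := by
    intro y hy
    obtain ⟨ρ, hρ, hy⟩ := List.mem_flatMap.1 hy
    have hρ' := List.mem_range.1 hρ
    obtain ⟨hf, hs, -⟩ := hfs ρ hρ'
    simp only [List.mem_cons, List.not_mem_nil, or_false] at hy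
    rcases hy with rfl | rfl
    · exact ⟨ρ, hρ', rfl, fstC ρ, hf, rfl⟩
    · exact ⟨ρ, hρ', rfl, sndC ρ, hs, rfl⟩
  unfold rpEdgesN
  rw [List.pairwise_append]
  refine ⟨?_, ?_, fun x hx y hy => ?_⟩
  · -- the rails
    rw [List.pairwise_flatMap]
    refine ⟨fun r hr => ?_, ?_⟩
    · -- one rail
      obtain ⟨hu, hv⟩ := hends r (List.mem_range.1 hr)
      unfold railEdgesN
      rw [List.cons_append, List.pairwise_cons, List.pairwise_append]
      refine ⟨fun e' he' => ?_, ?_, List.pairwise_singleton _ _, ?_⟩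
      · rcases List.mem_append.1 he' with he' | he'
        · obtain ⟨i, -, rfl⟩ := List.mem_map.1 he'
          exact udistinct_of_fst (by simp only; omega) (by simp only; omega)
        · rw [List.mem_singleton.1 he']
          exact udistinct_of_snd (by simp only; omega) (by simp only; omega)
      · rw [List.pairwise_map]
        exact (List.pairwise_lt_range).imp fun {i i'} hlt => by unfold UDistinct; simp only; omega
      · intro e' he' e'' he''
        obtain ⟨i, hi, rfl⟩ := List.mem_map.1 he'
        have hi' := List.mem_range.1 hi
        rw [List.mem_singleton.1 he'']
        exact udistinct_of_fst (by simp only; omega) (by simp only; omega)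
    · -- two rails `r < r'`
      refine (List.pairwise_lt_range).imp_of_mem fun {r r'} hr hr' hrr => ?_
      intro x hx y hy
      obtain ⟨hu, hv⟩ := hends r (List.mem_range.1 hr)
      obtain ⟨hu', hv'⟩ := hends r' (List.mem_range.1 hr')
      obtain ⟨-, t, ht, hx2⟩ := railEdgesN_shape (by omega) hu hv hx
      obtain ⟨hy1, t', ht', hy2⟩ := railEdgesN_shape (by omega) hu' hv' hy
      have h1 := hsep (t' := t') hrr ht
      refine udistinct_of_snd ?_ (by rw [hx2, hy2]; omega)
      rcases hy1 with hy1 | ⟨t'', ht'', hy1⟩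
      · rw [hx2]; omega
      · have h2 := hsep (t' := t'') hrr ht
        rw [hx2, hy1]; omega
  · -- the rungs
    rw [List.pairwise_flatMap]
    refine ⟨fun ρ hρ => ?_, ?_⟩
    · obtain ⟨-, hs, hne⟩ := hfs ρ (List.mem_range.1 hρ)
      refine List.pairwise_pair.2 ?_
      unfold UDistinct; simp only; omega
    · refine (List.pairwise_lt_range).imp_of_mem fun {ρ ρ'} hρ hρ' hlt' => ?_
      intro x hx y hy
      obtain ⟨hf', hs', -⟩ := hfs ρ' (List.mem_range.1 hρ')
      simp only [List.mem_cons, List.not_mem_nil, or_false] at hx hy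
      rcases hx with rfl | rfl <;> rcases hy with rfl | rfl <;> exact udistinct_of_fst (by simp only; omega) (by simp only; omega)
  · -- a rail edge against a rung edge
    obtain ⟨r, hr, hx1, t, ht, hx2⟩ := railShape hx
    obtain ⟨ρ, hρ, hy1, c, hc, hy2⟩ := rungShape hy
    have := hlt hr ht
    refine (udistinct_of_fst ?_ ?_).symm
    · rcases hx1 with hx1 | ⟨t', ht', hx1⟩
      · rw [hy1]; omega
      · have := hlt hr ht'; rw [hy1, hx1]; omega
    · rw [hy1, hx2]; omega

/-- Every edge of a placed rail gadget has an end in the block `[base, base + k K + m)`, and all its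
ends are below the base or in the block. [folklore] -/
theorem rpEdgesN_ends {k K m base : ℕ} {ends : ℕ → ℕ × ℕ} {fstC sndC : ℕ → ℕ} (hK : 1 ≤ K)
    (hends : ∀ r < k, (ends r).1 < base ∧ (ends r).2 < base) (hfs : ∀ ρ < m, fstC ρ < k * K ∧ sndC ρ < k * K)
    {e : ℕ × ℕ} (he : e ∈ rpEdgesN k K m base ends fstC sndC) :
    (base ≤ e.2 ∧ e.2 < base + (k * K + m) ∨ base ≤ e.1 ∧ e.1 < base + (k * K + m)) ∧
      (e.1 < base ∨ (base ≤ e.1 ∧ e.1 < base + (k * K + m))) ∧ (e.2 < base ∨ (base ≤ e.2 ∧ e.2 < base + (k * K + m))) := by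
  have hlt : ∀ {r t : ℕ}, r < k → t < K → r * K + t < k * K := fun {r t} hr ht => by
    have : (r + 1) * K ≤ k * K := Nat.mul_le_mul_right _ hr
    rw [Nat.add_mul, one_mul] at this; omega
  rcases mem_rpEdgesN_iff.1 he with ⟨r, hr, he⟩ | ⟨ρ, hρ, he⟩
  · obtain ⟨hu, hv⟩ := hends r hr
    obtain ⟨h1, t, ht, h2⟩ := railEdgesN_shape hK hu hv he
    have := hlt hr ht
    refine ⟨Or.inl ⟨by omega, by omega⟩, ?_, Or.inr ⟨by omega, by omega⟩⟩
    rcases h1 with h1 | ⟨t', ht', h1⟩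
    · exact Or.inl h1
    · have := hlt hr ht'; exact Or.inr ⟨by omega, by omega⟩
  · obtain ⟨hf, hs⟩ := hfs ρ hρ
    rcases he with rfl | rfl <;> simp only <;> omega

/-! ### The graph of a formula -/

variable (ψ : CNF ℕ)

/-- The cell edge lists have no repeated unordered pair (a finite check). [folklore] -/
theorem edgeList_pairwise (ty : CellTy) :
    ty.edgeList.Pairwise fun e e' => ¬ ((e.1 = e'.1 ∧ e.2 = e'.2) ∨ (e.1 = e'.2 ∧ e.2 = e'.1)) := by
  cases ty <;> decide

/-- The ends of a chain edge of cell `kc`: the first end is in cell `kc`, the second in cell `kc`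
or it is the next connector. [folklore] -/
theorem chainBlock_shape {kc : ℕ} {e : ℕ × ℕ}
    (he : e ∈ (conn kc, vtx kc (cellTyAt ψ kc).pIdx) :: cellEdgesN kc (cellTyAt ψ kc) ++
      (if kc + 1 < ncells ψ then [(vtx kc (cellTyAt ψ kc).qIdx, conn (kc + 1))] else [])) :
    e.1 / 17 = kc ∧ (e.2 / 17 = kc ∨ e.2 = conn (kc + 1)) := by
  simp only [List.cons_append, List.mem_cons, List.mem_append] at he
  rcases he with rfl | he | he
  · exact ⟨GridCell.conn_div kc, Or.inl (GridCell.vtx_div kc _)⟩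
  · obtain ⟨a, b, -, rfl⟩ := mem_cellEdgesN_iff.1 he
    exact ⟨GridCell.vtx_div kc a, Or.inl (GridCell.vtx_div kc b)⟩
  · split_ifs at he with h
    · rw [List.mem_singleton.1 he]; exact ⟨GridCell.vtx_div kc _, Or.inr rfl⟩
    · simp at he

/-- **The chain edges are pairwise distinct as unordered pairs.** [folklore] -/
theorem chainEdgesN_pairwise : (chainEdgesN ψ).Pairwise UDistinct := by
  unfold chainEdgesN
  rw [List.pairwise_flatMap]
  refine ⟨fun kc _ => ?_, ?_⟩
  · -- one cell
    rw [List.cons_append, List.pairwise_cons, List.pairwise_append]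
    refine ⟨fun e' he' => ?_, ?_, ?_, ?_⟩
    · -- the entry edge against the others: its first end is the connector
      refine udistinct_of_fst ?_ ?_
      · rcases List.mem_append.1 he' with he' | he'
        · obtain ⟨a, b, -, rfl⟩ := mem_cellEdgesN_iff.1 he'; exact (GridCell.vtx_ne_conn kc kc a).symm
        · split_ifs at he'
          · rw [List.mem_singleton.1 he']; exact (GridCell.vtx_ne_conn kc kc _).symm
          · simp at he'
      · rcases List.mem_append.1 he' with he' | he'
        · obtain ⟨a, b, -, rfl⟩ := mem_cellEdgesN_iff.1 he'; exact (GridCell.vtx_ne_conn kc kc b).symm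
        · split_ifs at he'
          · rw [List.mem_singleton.1 he']; simp only [GridCell.conn]; omega
          · simp at he'
    · -- the cell edges
      unfold cellEdgesN
      rw [List.pairwise_map]
      refine (edgeList_pairwise _).imp fun {e e'} h => ?_
      unfold UDistinct
      simp only [GridCell.vtx_inj, true_and]
      contrapose! h
      rcases h with ⟨h1, h2⟩ | ⟨h1, h2⟩
      · exact Or.inl ⟨h1, h2⟩
      · exact Or.inr ⟨h1, h2⟩
    · split_ifs
      · exact List.pairwise_singleton _ _
      · exact List.Pairwise.nil
    · intro e he e' he'
      split_ifs at he' with h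
      · rw [List.mem_singleton.1 he']
        obtain ⟨a, b, -, rfl⟩ := mem_cellEdgesN_iff.1 he
        exact (udistinct_of_snd (GridCell.vtx_ne_conn kc (kc + 1) a).symm (GridCell.vtx_ne_conn kc (kc + 1) b).symm).symm
      · simp at he'
  · -- two cells `kc < kc'`
    refine (List.pairwise_lt_range).imp fun {kc kc'} hlt => ?_
    intro x hx y hy
    obtain ⟨hx1, -⟩ := chainBlock_shape ψ hx
    obtain ⟨hy1, hy2⟩ := chainBlock_shape ψ hy
    refine udistinct_of_fst (fun h => ?_) (fun h => ?_)
    · rw [h] at hx1; omega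
    · rw [h] at hx1
      rcases hy2 with hy2 | hy2
      · omega
      · rw [hy2, GridCell.conn_div] at hx1; omega

/-- Both ends of a chain edge are chain vertices (below `17 · ncells`). [folklore] -/
theorem lt_of_mem_chainEdgesN {e : ℕ × ℕ} (he : e ∈ chainEdgesN ψ) : e.1 < 17 * ncells ψ ∧ e.2 < 17 * ncells ψ := by
  obtain ⟨kc, hk, h⟩ := (mem_chainEdgesN_iff ψ).1 he
  rcases h with rfl | h | ⟨hk1, rfl⟩
  · simp only [GridCell.conn, GridCell.vtx]; constructor <;> (have := ((cellTyAt ψ kc).pIdx).isLt; omega)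
  · obtain ⟨a, b, -, rfl⟩ := mem_cellEdgesN_iff.1 h
    simp only [GridCell.vtx]; have := a.isLt; have := b.isLt; constructor <;> omega
  · simp only [GridCell.conn, GridCell.vtx]; have := ((cellTyAt ψ kc).qIdx).isLt; constructor <;> omega

/-- The rung tables of the three-input OR-gadget: codes among the nodes, distinct ends. [folklore] -/
theorem or3C_ok : ∀ ρ < 9, or3FstC ρ < 3 * 6 ∧ or3SndC ρ < 3 * 6 ∧ or3FstC ρ ≠ or3SndC ρ := by decide

/-- The first end of a rail edge is one of the two ports or a node. [folklore] -/
theorem railEdgesN_fst_cases {K base u v r : ℕ} {e : ℕ × ℕ} (he : e ∈ railEdgesN K base u v r) :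
    e.1 = u ∨ e.1 = v ∨ ∃ t < K, e.1 = base + r * K + t := by
  rcases mem_railEdgesN_iff.1 he with rfl | ⟨i, hi, rfl⟩ | rfl
  · exact Or.inl rfl
  · exact Or.inr (Or.inr ⟨i, by omega, rfl⟩)
  · exact Or.inr (Or.inl rfl)

/-- **The edges of a placed rail gadget on chain slots**: pairwise distinct, every edge has an end
in the block `[base, base + 64)`, all ends are chain vertices or in the block. [folklore] -/
theorem rpEdgesN_facts {k K m base : ℕ} {ends : ℕ → ℕ × ℕ} {fstC sndC : ℕ → ℕ} (hK : 2 ≤ K) (hsize : k * K + m ≤ 64)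
    (hbase : 17 * ncells ψ ≤ base) (hends : ∀ r < k, (ends r).1 < 17 * ncells ψ ∧ (ends r).2 < 17 * ncells ψ)
    (hfs : ∀ ρ < m, fstC ρ < k * K ∧ sndC ρ < k * K ∧ fstC ρ ≠ sndC ρ) :
    (rpEdgesN k K m base ends fstC sndC).Pairwise UDistinct ∧ ∀ e ∈ rpEdgesN k K m base ends fstC sndC,
      (base ≤ e.2 ∧ e.2 < base + 64 ∨ base ≤ e.1 ∧ e.1 < base + 64) ∧
        (e.1 < 17 * ncells ψ ∨ (base ≤ e.1 ∧ e.1 < base + 64)) ∧ (e.2 < 17 * ncells ψ ∨ (base ≤ e.2 ∧ e.2 < base + 64)) := by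
  have hends' : ∀ r < k, (ends r).1 < base ∧ (ends r).2 < base := fun r hr => ⟨by have := (hends r hr).1; omega, by have := (hends r hr).2; omega⟩
  refine ⟨rpEdgesN_pairwise hK hends' hfs, fun e he => ?_⟩
  obtain ⟨h1, h2, h3⟩ := rpEdgesN_ends (by omega) hends' (fun ρ hρ => ⟨(hfs ρ hρ).1, (hfs ρ hρ).2.1⟩) he
  refine ⟨?_, ?_, ?_⟩
  · rcases h1 with h1 | h1
    · exact Or.inl ⟨h1.1, by omega⟩
    · exact Or.inr ⟨h1.1, by omega⟩
  · rcases h2 with h2 | h2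
    · rcases mem_rpEdgesN_iff.1 he with ⟨r, hr, he⟩ | ⟨ρ, hρ, he⟩
      · rcases railEdgesN_fst_cases he with h | h | ⟨t, -, h⟩
        · rw [h]; exact Or.inl (hends r hr).1
        · rw [h]; exact Or.inl (hends r hr).2
        · omega
      · rcases he with rfl | rfl <;> simp only at h2 <;> omega
    · exact Or.inr ⟨h2.1, by omega⟩
  · rcases h3 with h3 | h3
    · rcases mem_rpEdgesN_iff.1 he with ⟨r, hr, he⟩ | ⟨ρ, hρ, he⟩
      · obtain ⟨-, t, -, ht⟩ := railEdgesN_shape (by omega) (hends' r hr).1 (hends' r hr).2 he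
        omega
      · rcases he with rfl | rfl <;> simp only at h3 <;> omega
    · exact Or.inr ⟨h3.1, by omega⟩

/-- A global slot of a cell has chain-vertex ends. [folklore] -/
theorem gs_lt {k : ℕ} (hk : k < ncells ψ) (e : Fin 16 × Fin 16) : (gs k e).1 < 17 * ncells ψ ∧ (gs k e).2 < 17 * ncells ψ := by
  simp only [gs, GridCell.vtx]
  have := e.1.isLt; have := e.2.isLt
  constructor <;> nlinarith

/-- **The edges of a gadget**: pairwise distinct, every edge has an end in the gadget's block, all
ends are chain vertices or in the block. [folklore] -/
theorem placeEdges_facts (g : ℕ) :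
    (placeEdges ψ g).Pairwise UDistinct ∧ ∀ e ∈ placeEdges ψ g,
      (gbase ψ g ≤ e.2 ∧ e.2 < gbase ψ g + 64 ∨ gbase ψ g ≤ e.1 ∧ e.1 < gbase ψ g + 64) ∧
        (e.1 < 17 * ncells ψ ∨ (gbase ψ g ≤ e.1 ∧ e.1 < gbase ψ g + 64)) ∧
        (e.2 < 17 * ncells ψ ∨ (gbase ψ g ≤ e.2 ∧ e.2 < gbase ψ g + 64)) := by
  have hgb : 17 * ncells ψ ≤ gbase ψ g := by unfold gbase; omega
  rw [placeEdges_eq]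
  cases hs : gad ψ g with
  | none => simp
  | some spec =>
    simp only [Option.elim_some]
    split_ifs with hok
    swap; · simp
    cases spec with
    | xor k₁ e₁ k₂ e₂ =>
      obtain ⟨hk₁, hk₂, -, -, -⟩ := hok
      refine rpEdgesN_facts ψ (by norm_num) (by norm_num) hgb (fun r hr => ?_) (fun ρ hρ => ⟨by omega, by omega, by omega⟩)
      interval_cases r
      · simpa using gs_lt ψ hk₁ e₁
      · simpa using gs_lt ψ hk₂ e₂
    | or1 k =>
      have hk : k < ncells ψ := hok
      refine rpEdgesN_facts ψ (by norm_num) (by norm_num) hgb (fun r _ => gs_lt ψ hk bS0) (fun ρ hρ => ⟨by omega, by omega, by omega⟩)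
    | or3 k =>
      have hk : k + 2 < ncells ψ := hok
      refine rpEdgesN_facts ψ (by norm_num) (by norm_num) hgb (fun r hr => ?_) (fun ρ hρ => or3C_ok ρ hρ)
      interval_cases r
      · simpa using gs_lt ψ (show k < ncells ψ by omega) bS0
      · simpa using gs_lt ψ (show k + 1 < ncells ψ by omega) bS0
      · simpa using gs_lt ψ hk bS0

/-- **The edge list of the graph of `ψ` has no repeated unordered pair.** [folklore] -/
theorem edgesOf_pairwise : (edgesOf ψ).Pairwise UDistinct := by
  unfold edgesOf
  rw [List.pairwise_append]
  refine ⟨(chainEdgesN_pairwise ψ).filter _, ?_, fun x hx y hy => ?_⟩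
  · rw [List.pairwise_flatMap]
    refine ⟨fun g _ => (placeEdges_facts ψ g).1, ?_⟩
    refine (List.pairwise_lt_range).imp fun {g g'} hlt => ?_
    intro x hx y hy
    obtain ⟨hx1, -, -⟩ := (placeEdges_facts ψ g).2 x hx
    obtain ⟨-, hy1, hy2⟩ := (placeEdges_facts ψ g').2 y hy
    have hgg : gbase ψ g + 64 ≤ gbase ψ g' := by unfold gbase; omega
    have hgb : 17 * ncells ψ ≤ gbase ψ g := by unfold gbase; omega
    rcases hx1 with ⟨h1, h2⟩ | ⟨h1, h2⟩
    · exact udistinct_of_snd (by omega) (by omega)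
    · exact udistinct_of_fst (by omega) (by omega)
  · have hx' := (List.mem_filter.1 hx).1
    obtain ⟨h1, h2⟩ := lt_of_mem_chainEdgesN ψ hx'
    obtain ⟨g, -, hy⟩ := List.mem_flatMap.1 hy
    obtain ⟨hy1, -, -⟩ := (placeEdges_facts ψ g).2 y hy
    have hgb : 17 * ncells ψ ≤ gbase ψ g := by unfold gbase; omega
    rcases hy1 with ⟨hy1, -⟩ | ⟨hy1, -⟩
    · exact (udistinct_of_snd (by omega) (by omega)).symm
    · exact (udistinct_of_fst (by omega) (by omega)).symm

end GridFormulaFP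

end Literature.Barriers.CriticalPhenomena.GridSAW
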